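import Summits.AtomisticToContinuum.Crystallization.Theorems.FluxTubeKeplerFloorGivesLayered
import Summits.AtomisticToContinuum.Crystallization.Theorems.FluxTubeKeplerFluxCellKeplerSingleScale
import Summits.AtomisticToContinuum.Crystallization.Theorems.ChessboardParticlePlanesPeriodicWindowsIffCrystallization

/-!
# `SparseBlindRung` — F4 on-path lemma: `Crystallization → SparseBlindRung` (no `sorry`)

Forward rung over `FluxTubeKepler.FloorGivesLayered` (crux dir `FluxCellKepler`, stmt-AtomisticToContinuum-15221;
fwd-rung G1 gen 21).  Re-declares the crowd ladder of `Lines/SparseBlindRung.lean` in the namespace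
`…CrowdLadder.OnPath` (same definitions, verbatim) and proves, sorry-free, that the sub-problem implies every member
`CrowdRung θ κ` and the deciding rung `SparseBlindRung` (via the landed hull-criterion converse
`ChessboardParticlePlanesPeriodicWindowsIffCrystallization.periodicWindows_of_crystallization`), the deciding lemma
tagged `@[aesop safe apply]`; the kernel's `S → C` probe `example : _root_.Crystallization → SparseBlindRung := by aesop`
is replayed at the end.
-/

noncomputable section

namespace Summit.AtomisticToContinuum.Crystallization.Cruxes.FluxCellKepler.CrowdLadder.OnPath

open scoped BigOperators Classical
open Filter Topology
open Literature.MathematicalPhysics.StatisticalMechanics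
open Summit.AtomisticToContinuum.Crystallization.Theorems.FluxCellKeplerSingleScale (LayeredGood layeredGood_mono)
open Summit.AtomisticToContinuum.Crystallization.Theorems.ChargedEnergyGapNegative (eStar)

local notation "E3" => EuclideanSpace ℝ (Fin 3)

/-! ## The object of the ladder: crowded sites at the mesoscale `θ·N^{1/3}` -/

/-- **`(θ,κ)`-CROWDED**: at least `κ·N` particles of the configuration (the site itself included) lie within
`θ·N^{1/3}` of `x i`.  Template-free, potential-free, purely metric; for `κ ≤ 0` every site is crowded. -/
def Crowded (θ κ : ℝ) {N : ℕ} (x : Fin N → E3) (i : Fin N) : Prop :=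
  κ * (N : ℝ) ≤ (Nat.card {j : Fin N // dist (x j) (x i) ≤ θ * (N : ℝ) ^ (1 / 3 : ℝ)} : ℝ)

/-! ## The rung family -/

/-- FLOOR(P₀): `N · e(P₀) ≤ E(x)` for every Lennard-Jones ground state `x` of every size `N`
(verbatim the first hypothesis of `FluxTubeKepler.FloorGivesLayered`). -/
def Floor (P₀ : PeriodicConfiguration 3) : Prop :=
  ∀ (N : ℕ) (x : Fin N → E3), IsGroundState lennardJones x →
    (N : ℝ) * P₀.energyPerParticle lennardJones ≤ interactionEnergy lennardJones x

/-- CROWD BUDGET at mesoscale `θ` and filling `κ`: for every radius `R > 0` and tolerance `η > 0` some `c > 0` prices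
the sites of every Lennard-Jones ground state that are `(R,η)`-non-layered AND `(θ,κ)`-crowded, against the excess
energy over `N · e(P₀)` (`κ = 0`: the floor's budget, every non-layered site priced; quantifier order `∀ R η ∃ c` of
the crux kept — Disproof §5: no `c` uniform in `R`). -/
def CrowdBudget (θ κ : ℝ) (P₀ : PeriodicConfiguration 3) : Prop :=
  ∀ R η : ℝ, 0 < R → 0 < η → ∃ c : ℝ, 0 < c ∧
    ∀ (N : ℕ) (x : Fin N → E3), IsGroundState lennardJones x →
      c * (Nat.card {i : Fin N // ¬ LayeredGood R η x i ∧ Crowded θ κ x i} : ℝ) ≤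
        interactionEnergy lennardJones x - (N : ℝ) * P₀.energyPerParticle lennardJones

/-- Periodic windows at every scale along the sequence `x` (ONE periodic `P`, translations only) —
verbatim the conclusion of `FluxTubeKepler.PeriodicWindows` / `FluxTubeKepler.PeriodicGivenLayered`. -/
def HasPeriodicWindows (x : (N : ℕ) → (Fin N → E3)) : Prop :=
  ∃ P : PeriodicConfiguration 3, ∀ R ε : ℝ, 0 < ε → ∃ᶠ N in atTop, ∃ t : E3,
    (∀ q ∈ P.points, ‖q‖ ≤ R → ∃ i : Fin N, dist (x N i + t) q ≤ ε) ∧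
    (∀ i : Fin N, ‖x N i + t‖ ≤ R → ∃ q ∈ P.points, dist (x N i + t) q ≤ ε)

/-- **The graded family.** `CrowdRung θ κ`: FLOOR and the crowd budget at `(θ, κ)` force periodic windows along every
Lennard-Jones ground-state sequence. -/
def CrowdRung (θ κ : ℝ) : Prop :=
  ∀ P₀ : PeriodicConfiguration 3, Floor P₀ → CrowdBudget θ κ P₀ →
    ∀ x : (N : ℕ) → (Fin N → E3), (∀ N, IsGroundState lennardJones (x N)) → HasPeriodicWindows x

/-- **Deciding rung**: at every mesoscale `θ` some positive filling fraction `κ` may be exempted — a certificate blind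
to every mesoscopically sparse region still forces crystallization of the ground states. -/
def SparseBlindRung : Prop := ∀ θ : ℝ, 0 < θ → ∃ κ : ℝ, 0 < κ ∧ CrowdRung θ κ

/-! ## Counting helpers -/

theorem natCard_mono {N : ℕ} {p q : Fin N → Prop} (h : ∀ i, p i → q i) :
    Nat.card {i // p i} ≤ Nat.card {i // q i} := by
  rw [Nat.card_eq_fintype_card, Nat.card_eq_fintype_card]
  exact Fintype.card_subtype_mono _ _ h

/-- For `κ ≤ 0` every site is crowded. -/
theorem crowded_of_nonpos {θ κ : ℝ} (hκ : κ ≤ 0) {N : ℕ} (x : Fin N → E3) (i : Fin N) : Crowded θ κ x i :=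
  (mul_nonpos_of_nonpos_of_nonneg hκ (Nat.cast_nonneg N)).trans (Nat.cast_nonneg _)

/-- Crowdedness is antitone in the filling fraction. -/
theorem crowded_anti {θ κ κ' : ℝ} (hκ : κ ≤ κ') {N : ℕ} (x : Fin N → E3) (i : Fin N) :
    Crowded θ κ' x i → Crowded θ κ x i := fun h =>
  (mul_le_mul_of_nonneg_right hκ (Nat.cast_nonneg N)).trans h

/-- Crowdedness is monotone in the mesoscale. -/
theorem crowded_mono_scale {θ θ' κ : ℝ} (hθ : θ ≤ θ') {N : ℕ} (x : Fin N → E3) (i : Fin N) :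
    Crowded θ κ x i → Crowded θ' κ x i := fun h => by
  refine h.trans ?_
  have hr : θ * (N : ℝ) ^ (1 / 3 : ℝ) ≤ θ' * (N : ℝ) ^ (1 / 3 : ℝ) :=
    mul_le_mul_of_nonneg_right hθ (Real.rpow_nonneg (Nat.cast_nonneg N) _)
  exact_mod_cast natCard_mono (p := fun j => dist (x j) (x i) ≤ θ * (N : ℝ) ^ (1 / 3 : ℝ))
    (q := fun j => dist (x j) (x i) ≤ θ' * (N : ℝ) ^ (1 / 3 : ℝ)) fun j hj => hj.trans hr

/-! ## F3 — the family specialises to the proved floor -/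

/-- At filling `0` the crowd budget IS the floor's budget. -/
theorem crowdBudget_zero_iff (θ : ℝ) (P₀ : PeriodicConfiguration 3) :
    CrowdBudget θ 0 P₀ ↔
      ∀ R η : ℝ, 0 < R → 0 < η → ∃ c : ℝ, 0 < c ∧
        ∀ (N : ℕ) (x : Fin N → E3), IsGroundState lennardJones x →
          c * (Nat.card {i : Fin N // ¬ LayeredGood R η x i} : ℝ) ≤
            interactionEnergy lennardJones x - (N : ℝ) * P₀.energyPerParticle lennardJones := by
  simp only [CrowdBudget, Crowded, zero_mul, Nat.cast_nonneg, and_true]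

/-- `CrowdRung θ 0` is the floor: the seed theorem followed by the proved `PeriodicGivenLayered`. -/
theorem crowdRung_zero (θ : ℝ) : CrowdRung θ 0 := fun P₀ hF hB x hx =>
  Theses.FluxTubeKepler.PeriodicGivenLayered_holds x hx
    (Theorems.FluxTubeKeplerFloorGivesLayered.FloorGivesLayered_proof P₀ hF
      ((crowdBudget_zero_iff θ P₀).1 hB) x hx)

/-! ## Dial: larger filling / smaller mesoscale = stronger rung; `κ ≤ 0` = the floor -/

/-- A budget pricing a superset implies the budget pricing the subset: `CrowdBudget θ κ → CrowdBudget θ κ'` for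
`κ ≤ κ'`. -/
theorem crowdBudget_mono (θ : ℝ) {κ κ' : ℝ} (hκ : κ ≤ κ') (P₀ : PeriodicConfiguration 3) :
    CrowdBudget θ κ P₀ → CrowdBudget θ κ' P₀ := by
  intro hB R η hR hη
  obtain ⟨c, hc, hcB⟩ := hB R η hR hη
  refine ⟨c, hc, fun N x hx => le_trans ?_ (hcB N x hx)⟩
  have hle : Nat.card {i : Fin N // ¬ LayeredGood R η x i ∧ Crowded θ κ' x i} ≤
      Nat.card {i : Fin N // ¬ LayeredGood R η x i ∧ Crowded θ κ x i} :=
    natCard_mono fun i hi => ⟨hi.1, crowded_anti hκ x i hi.2⟩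
  exact mul_le_mul_of_nonneg_left (by exact_mod_cast hle) hc.le

/-- Same along the mesoscale: `CrowdBudget θ' κ → CrowdBudget θ κ` for `θ ≤ θ'`. -/
theorem crowdBudget_anti_scale {θ θ' : ℝ} (hθ : θ ≤ θ') (κ : ℝ) (P₀ : PeriodicConfiguration 3) :
    CrowdBudget θ' κ P₀ → CrowdBudget θ κ P₀ := by
  intro hB R η hR hη
  obtain ⟨c, hc, hcB⟩ := hB R η hR hη
  refine ⟨c, hc, fun N x hx => le_trans ?_ (hcB N x hx)⟩
  have hle : Nat.card {i : Fin N // ¬ LayeredGood R η x i ∧ Crowded θ κ x i} ≤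
      Nat.card {i : Fin N // ¬ LayeredGood R η x i ∧ Crowded θ' κ x i} :=
    natCard_mono fun i hi => ⟨hi.1, crowded_mono_scale hθ x i hi.2⟩
  exact mul_le_mul_of_nonneg_left (by exact_mod_cast hle) hc.le

/-- The dial in the filling: `CrowdRung θ κ' → CrowdRung θ κ` for `κ ≤ κ'`. -/
theorem crowdRung_anti (θ : ℝ) {κ κ' : ℝ} (hκ : κ ≤ κ') (h : CrowdRung θ κ') : CrowdRung θ κ :=
  fun P₀ hF hB x hx => h P₀ hF (crowdBudget_mono θ hκ P₀ hB) x hx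

/-- The dial in the mesoscale: `CrowdRung θ κ → CrowdRung θ' κ` for `θ ≤ θ'`. -/
theorem crowdRung_mono_scale {θ θ' : ℝ} (hθ : θ ≤ θ') (κ : ℝ) (h : CrowdRung θ κ) : CrowdRung θ' κ :=
  fun P₀ hF hB x hx => h P₀ hF (crowdBudget_anti_scale hθ κ P₀ hB) x hx

/-- Every member with `κ ≥ 0` implies the floor member (informational `specialises`). -/
theorem crowdRung_zero_of_crowdRung {θ κ : ℝ} (hκ : 0 ≤ κ) (h : CrowdRung θ κ) : CrowdRung θ 0 :=
  crowdRung_anti θ hκ h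

/-- Members with `κ ≤ 0` ARE the floor. -/
theorem crowdRung_of_nonpos (θ : ℝ) {κ : ℝ} (hκ : κ ≤ 0) : CrowdRung θ κ :=
  crowdRung_anti θ hκ (crowdRung_zero θ)

/-- The deciding rung hands down every smaller positive filling at the same mesoscale. -/
theorem crowdRung_of_sparseBlindRung (h : SparseBlindRung) {θ : ℝ} (hθ : 0 < θ) :
    ∃ κ : ℝ, 0 < κ ∧ ∀ κ' : ℝ, κ' ≤ κ → CrowdRung θ κ' := by
  obtain ⟨κ, hκ, hR⟩ := h θ hθ
  exact ⟨κ, hκ, fun κ' hκ' => crowdRung_anti θ hκ' hR⟩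

/-! ## F4 — on-path lemmas: the sub-problem implies every member -/

/-- ON-PATH: `Crystallization → CrowdRung θ κ` (landed hull-criterion converse `periodicWindows_of_crystallization`). -/
theorem crowdRung_of_crystallization (θ κ : ℝ) (h : _root_.Crystallization) : CrowdRung θ κ :=
  fun _ _ _ x hx =>
    Theorems.ChessboardParticlePlanesPeriodicWindowsIffCrystallization.periodicWindows_of_crystallization h x hx

/-- ON-PATH for the deciding rung (tagged `aesop safe apply` so that the tribunal's fixed `S → C` portfolio finds it). -/
@[aesop safe apply]
theorem SparseBlindRung_of_Crystallization (h : _root_.Crystallization) : SparseBlindRung :=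
  fun θ _ => ⟨1, one_pos, crowdRung_of_crystallization θ 1 h⟩

/-! ## The kernel's `S → C` probe, replayed -/

example : _root_.Crystallization → SparseBlindRung := by aesop

example (θ κ : ℝ) : _root_.Crystallization → CrowdRung θ κ := crowdRung_of_crystallization θ κ


end Summit.AtomisticToContinuum.Crystallization.Cruxes.FluxCellKepler.CrowdLadder.OnPath

end
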